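import Mathlib
import Summits.NavierStokesRegularity.NavierStokesRegularity.Theorems.EulerZoomLiouvillePowerGaugeEulerLiouvilleDSSSimilarityBernoulliMember
import HarnessLib.Audit

/-!
# Crux E `PowerGaugeEulerLiouville` (stmt-NavierStokesRegularity-19832): K-A FOR DSS MEMBERS WITHOUT TAMENESS — PIERCED MOVING SPHERES,
# A SUB-BERNOULLI PRESSURE CLOCK AND SUBCRITICAL PERMANENT NODES (width seat ns-cas-k2 g2; g0's K-A′ with `hconf` discharged for DSS members)

Route `EulerZoomLiouville` (NavierStokesRegularity), crux E.  ns-cas-k2 g0's K-A′ `…MovingSpherePiercing` (p627425) handles DSS members whose profile may be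
UNBOUNDED at infinity through the irrotational fast-inflow PIERCING of moving spheres beyond every radius, modulo the confined-null binder `hconf`.  For an
`l`-DSS classical member (velocity AND pressure class laws) the scale-invariant sizes `(−s)^{1−n}‖u‖`, `(−s)‖∇u‖`, `(−s)^{2−2n}p`, `(−s)^{2−n}‖∇p‖` are bounded on
every moving ball AUTOMATICALLY (periodicity + continuity on the compact fundamental piece: `exists_velocity_core_bounds_of_dss`, `…Pressure`), so the
sub-Bernoulli pressure clock + subcritical permanent nodes kill every CONFINED trajectory (`dss_curl_eq_zero_of_confined_core`) and `hconf` holds with EMPTY sets: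
* `curl_eq_zero_of_confinedNull_of_boundedSpeed` — PORTRAIT: for members with bounded scaled speed g0's binder `hconf` alone already forces
  `curl u ≡ 0` (trapping makes the piercing vacuous): `hconf` is the core Liouville problem, which is why K-A needs the clock + nodes instead;
* `ae_eq_zero_of_gauge_of_dss_piercing_of_clock` — crux hypotheses (every `ρ > 0`) + classical with a continuous gradient majorant `Λ` (Cauchy–Lipschitz flow; NO
  tameness, NO bounded profile) + velocity DSS law + pressure clock (`θ < 1`) + scale-invariant pressure bounds on moving balls + pointwise-subcritical exactly
  self-similar particle paths + irrotational fast-inflow piercing beyond every radius ⇒ `u = 0` a.e.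

WHAT THIS IS NOT: not NS regularity, not the crux E — DSS members violating the pressure clock, with a critical exactly self-similar particle path, or with
vortical fast inflow on all large moving spheres are untouched. [folklore]
-/

noncomputable section

set_option linter.dupNamespace false

open MeasureTheory Set Filter Topology Metric Function
open scoped NNReal ENNReal ContDiff InnerProductSpace RealInnerProductSpace

namespace Summit.NavierStokesRegularity.NavierStokesRegularity.Theorems.PowerGaugeEulerLiouville.SimilarityBernoulli

open Literature.Analysis Literature.Analysis.FluidPDE Literature.Analysis.FunctionSpaces
open Summit.NavierStokesRegularity.NavierStokesRegularity.Theorems.PowerGaugeEulerLiouville.VorticityBirth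
open Summit.NavierStokesRegularity.NavierStokesRegularity.Theorems.PowerGaugeEulerLiouville.MovingSpherePiercing

variable {u : ℝ → EuclideanSpace ℝ (Fin 3) → EuclideanSpace ℝ (Fin 3)} {p : ℝ → EuclideanSpace ℝ (Fin 3) → ℝ} {Λ : ℝ → ℝ} {θ ρ l : ℝ}

/-! ### Automatic velocity core bounds of a DSS member -/

/-- **AUTOMATIC VELOCITY CORE BOUNDS FOR A DSS MEMBER**: if `u` is jointly smooth on `(−∞,0) × ℝ³` and obeys the class DSS law, then for every `R`
there is `K` with `(−s)^{1−n}‖u(s,x)‖ ≤ K` and `(−s)‖∇u(s,x)‖ ≤ K` whenever `‖x‖ ≤ R(−s)ⁿ`, `s < 0` (`n = 1/(2+ρ)`). [folklore] -/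
theorem exists_velocity_core_bounds_of_dss (hsm : IsSmoothSpaceTimeOn (Iio 0) u) (hl : 1 < l) (hρ : 0 < 2 + ρ)
    (hdss : ∀ τ : ℝ, τ < 0 → ∀ y, u τ y = (l ^ (1 + ρ)) • u ((l ^ (2 + ρ)) * τ) (l • y)) (R : ℝ) :
    ∃ K : ℝ, ∀ s : ℝ, s < 0 → ∀ x : EuclideanSpace ℝ (Fin 3), ‖x‖ ≤ R * (-s) ^ (2 + ρ)⁻¹ →
      (-s) * ‖fderiv ℝ (u s) x‖ ≤ K ∧ (-s) ^ (1 - (2 + ρ)⁻¹) * ‖u s x‖ ≤ K := by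
  have hl0 : 0 < l := zero_lt_one.trans hl
  set n : ℝ := (2 + ρ)⁻¹ with hn
  have hn0 : 0 ≤ n := (inv_pos.2 hρ).le
  set T : ℝ := l ^ (2 + ρ) with hT
  have hT1 : 1 < T := Real.one_lt_rpow hl hρ
  set D : Set (ℝ × EuclideanSpace ℝ (Fin 3)) := {z | z.1 ∈ Icc (-T) (-1) ∧ ‖z.2‖ ≤ R * (-z.1) ^ n} with hD
  have hDc : IsCompact D := by
    have hsub : D ⊆ Icc (-T) (-1) ×ˢ closedBall (0 : EuclideanSpace ℝ (Fin 3)) (|R| * T ^ n) := by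
      rintro ⟨t, x⟩ ⟨ht, hx⟩
      refine ⟨ht, mem_closedBall_zero_iff.2 (hx.trans ?_)⟩
      have h1 : (-t) ^ n ≤ T ^ n := Real.rpow_le_rpow (by linarith [ht.2]) (by linarith [ht.1]) hn0
      have h2 : 0 ≤ (-t) ^ n := Real.rpow_nonneg (by linarith [ht.2]) _
      calc R * (-t) ^ n ≤ |R| * (-t) ^ n := mul_le_mul_of_nonneg_right (le_abs_self R) h2
        _ ≤ |R| * T ^ n := mul_le_mul_of_nonneg_left h1 (abs_nonneg R)
    have hclosed : IsClosed D := by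
      have hc1 : Continuous fun z : ℝ × EuclideanSpace ℝ (Fin 3) => ‖z.2‖ := continuous_norm.comp continuous_snd
      have hc2 : Continuous fun z : ℝ × EuclideanSpace ℝ (Fin 3) => R * (-z.1) ^ n :=
        continuous_const.mul ((Real.continuous_rpow_const hn0).comp (continuous_neg.comp continuous_fst))
      rw [hD, setOf_and]
      exact (isClosed_Icc.preimage continuous_fst).inter (isClosed_le hc1 hc2)
    exact ((isCompact_Icc.prod (isCompact_closedBall _ _)).of_isClosed_subset hclosed hsub)
  have hDsub : D ⊆ Iio (0 : ℝ) ×ˢ (univ : Set (EuclideanSpace ℝ (Fin 3))) := fun z hz =>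
    ⟨by have := hz.1.2; show z.1 < 0; linarith, mem_univ _⟩
  have huc : ContinuousOn (uncurry u) (Iio (0:ℝ) ×ˢ univ) := hsm.continuousOn
  have hDuc : ContinuousOn (uncurry fun t x => fderiv ℝ (u t) x) (Iio (0:ℝ) ×ˢ univ) :=
    (hsm.fderiv_slice isOpen_Iio.uniqueDiffOn).continuousOn
  have hpow : ∀ q : ℝ, ContinuousOn (fun z : ℝ × EuclideanSpace ℝ (Fin 3) => (-z.1) ^ q) (Iio (0:ℝ) ×ˢ univ) := fun q z hz =>
    ((continuous_neg.comp continuous_fst).continuousAt.rpow_const (Or.inl (by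
      have : z.1 < 0 := hz.1; simp; linarith))).continuousWithinAt
  have hQ1 : ContinuousOn (fun z : ℝ × EuclideanSpace ℝ (Fin 3) => (-z.1) * ‖fderiv ℝ (u z.1) z.2‖) D :=
    (((continuous_neg.comp continuous_fst).continuousOn).mul hDuc.norm).mono hDsub
  have hQ2 : ContinuousOn (fun z : ℝ × EuclideanSpace ℝ (Fin 3) => (-z.1) ^ (1 - n) * ‖u z.1 z.2‖) D :=
    ((hpow _).mul huc.norm).mono hDsub
  obtain ⟨C₁, hC₁⟩ := hDc.exists_bound_of_continuousOn hQ1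
  obtain ⟨C₂, hC₂⟩ := hDc.exists_bound_of_continuousOn hQ2
  refine ⟨max C₁ C₂, fun s hs x hx => ?_⟩
  have key : ∀ t : ℝ, t ∈ Icc (-T) (-1) → ∀ z : EuclideanSpace ℝ (Fin 3), ‖z‖ ≤ R * (-t) ^ n →
      (-t) * ‖fderiv ℝ (u t) z‖ ≤ max C₁ C₂ ∧ (-t) ^ (1 - n) * ‖u t z‖ ≤ max C₁ C₂ := by
    intro t ht z hz
    have hmem : (t, z) ∈ D := ⟨ht, hz⟩
    exact ⟨(le_abs_self _).trans (((Real.norm_eq_abs _).symm.le.trans (hC₁ _ hmem)).trans (le_max_left _ _)),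
      (le_abs_self _).trans (((Real.norm_eq_abs _).symm.le.trans (hC₂ _ hmem)).trans (le_max_right _ _))⟩
  obtain ⟨m, t, ht, hcase⟩ := exists_fundamental_period hT1 hs
  have ht0 : t < 0 := by linarith [ht.2]
  have hlm : 0 < l ^ m := pow_pos hl0 m
  -- norm form of the gradient transfer
  have hgrad : ∀ (τ : ℝ), τ < 0 → ∀ y : EuclideanSpace ℝ (Fin 3),
      (-((l ^ (2 + ρ)) ^ m * τ)) * ‖fderiv ℝ (u ((l ^ (2 + ρ)) ^ m * τ)) (l ^ m • y)‖ = (-τ) * ‖fderiv ℝ (u τ) y‖ := by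
    intro τ hτ y
    have e1 := scaledFDeriv_dss_iterate hl hρ hdss m hτ y
    have := congrArg (fun L : EuclideanSpace ℝ (Fin 3) →L[ℝ] EuclideanSpace ℝ (Fin 3) => ‖L‖) e1
    simp only [norm_smul, Real.norm_eq_abs] at this
    have hTm : 0 < (l ^ (2 + ρ)) ^ m := pow_pos (Real.rpow_pos_of_pos hl0 _) m
    rwa [abs_of_pos (by nlinarith : 0 < -((l ^ (2 + ρ)) ^ m * τ)), abs_of_pos (by linarith : 0 < -τ)] at this
  rcases hcase with h | h
  · set z : EuclideanSpace ℝ (Fin 3) := (l ^ m)⁻¹ • x with hz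
    have hxz : l ^ m • z = x := by rw [hz, smul_smul, mul_inv_cancel₀ hlm.ne', one_smul]
    have hzR : ‖z‖ ≤ R * (-t) ^ n := by
      rw [← norm_smul_le_iff_dss hl hρ m ht0 R z, hxz, ← hT, ← h]; exact hx
    have e1 := hgrad t ht0 z
    have e2 := scaledSpeed_dss_iterate hl hρ hdss m ht0 z
    rw [hxz, ← hT, ← h] at e1 e2
    rw [e1, e2]
    exact key t ht z hzR
  · have hxR : ‖l ^ m • x‖ ≤ R * (-t) ^ n := by
      rw [h, hT, norm_smul_le_iff_dss hl hρ m hs R x]; exact hx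
    have e1 := hgrad s hs x
    have e2 := scaledSpeed_dss_iterate hl hρ hdss m hs x
    rw [← hT, ← h] at e1 e2
    rw [← e1, ← e2]
    exact key t ht (l ^ m • x) hxR

/-! ### DSS: confined trajectories carry no vorticity (core bounds only) -/

/-- **DSS, CORE FORM: CONFINED BACKWARD TRAJECTORIES CARRY NO VORTICITY.**  As `dss_curl_eq_zero_of_confined`, but the Type-I bounds on `∇u` and on the
scaled speed are only required ON THE MOVING BALL of radius `R` (the flow is provided by a continuous gradient majorant `Λ`). [folklore] -/
theorem dss_curl_eq_zero_of_confined_core (hcl : IsClassicalEulerSolutionOn (Iio 0) 0 u p) (hΛc : ContinuousOn Λ (Iio 0))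
    (hΛ : ∀ s : ℝ, s < 0 → ∀ y, ‖fderiv ℝ (u s) y‖ ≤ Λ s) (hρ : 0 < ρ) (hl : 1 < l)
    (hdss : ∀ τ : ℝ, τ < 0 → ∀ y, u τ y = (l ^ (1 + ρ)) • u ((l ^ (2 + ρ)) * τ) (l • y))
    {R K : ℝ} (hK : ∀ s : ℝ, s < 0 → ∀ x : EuclideanSpace ℝ (Fin 3), ‖x‖ ≤ R * (-s) ^ (2 + ρ)⁻¹ →
      (-s) * ‖fderiv ℝ (u s) x‖ ≤ K ∧ (-s) ^ (1 - (2 + ρ)⁻¹) * ‖u s x‖ ≤ K)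
    (hθ : θ < 1)
    (hclock : ∀ s : ℝ, s < 0 → ∀ x : EuclideanSpace ℝ (Fin 3),
      (-s) * timeDerivWithin (Iio 0) p s x - (2 + ρ)⁻¹ * fderiv ℝ (p s) x x - 2 * (1 - (2 + ρ)⁻¹) * p s x ≤
        θ * (1 - 2 * (2 + ρ)⁻¹) * ‖u s x + ((2 + ρ)⁻¹ / (-s)) • x‖ ^ 2)
    {P₀ G κ : ℝ} (hκ : κ < 1)
    (hP₀ : ∀ s : ℝ, s < 0 → ∀ x : EuclideanSpace ℝ (Fin 3), ‖x‖ ≤ R * (-s) ^ (2 + ρ)⁻¹ →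
      (-s) ^ (2 - 2 * (2 + ρ)⁻¹) * p s x ≤ P₀)
    (hG : ∀ s : ℝ, s < 0 → ∀ x : EuclideanSpace ℝ (Fin 3), ‖x‖ ≤ R * (-s) ^ (2 + ρ)⁻¹ →
      (-s) ^ (2 - (2 + ρ)⁻¹) * ‖gradient (p s) x‖ ≤ G)
    (hnode : ∀ y : EuclideanSpace ℝ (Fin 3), ‖y‖ ≤ R →
      (∀ t : ℝ, t < 0 → u t ((-t) ^ (2 + ρ)⁻¹ • y) = (-((2 + ρ)⁻¹ * (-t) ^ ((2 + ρ)⁻¹ - 1))) • y) →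
      ∀ t : ℝ, t < 0 → ∀ v : EuclideanSpace ℝ (Fin 3),
        (-t) * ⟪fderiv ℝ (u t) ((-t) ^ (2 + ρ)⁻¹ • y) v, v⟫ ≤ κ * ‖v‖ ^ 2)
    {τ₀ : ℝ} (hτ₀ : τ₀ < 0) {x₀ : EuclideanSpace ℝ (Fin 3)}
    (hconf : ∀ s : ℝ, s ≤ τ₀ → ‖ODE.evolutionMap u τ₀ s x₀‖ ≤ R * (-s) ^ (2 + ρ)⁻¹) :
    curl (u τ₀) x₀ = 0 := by
  have hρ2 : 0 < 2 + ρ := by linarith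
  set n : ℝ := (2 + ρ)⁻¹ with hn
  have hn0 : 0 ≤ n := (inv_pos.2 hρ2).le
  have hn2 : n < 1 / 2 := by
    rw [hn, inv_lt_comm₀ hρ2 (by norm_num)]; norm_num; linarith
  have hlip : ODE.IsUniformlyLipschitzOn u (Iio 0) := isUniformlyLipschitzOn hcl hΛc hΛ
  set X : ℝ → EuclideanSpace ℝ (Fin 3) := fun s => ODE.evolutionMap u τ₀ s x₀ with hX
  have hXd : ∀ s : ℝ, s < 0 → HasDerivAt X (u s (X s)) s := fun s hs =>
    hlip.hasDerivAt_evolutionMap (convex_Iio 0) hτ₀ (Iio_mem_nhds hs) x₀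
  have hconf' : ∀ s : ℝ, s ≤ τ₀ → ‖X s‖ ≤ R * (-s) ^ n := hconf
  have hrest := tendsto_similaritySpeed_zero_of_clock hcl hn0 hn2 hθ hclock hτ₀ hXd hconf'
    (fun s hs => (hK s (by linarith) (X s) (hconf' s hs)).2) (fun s hs => hP₀ s (by linarith) (X s) (hconf' s hs))
    (fun s hs => hG s (by linarith) (X s) (hconf' s hs))
  have hκ' : κ < (1 + κ) / 2 := by linarith
  obtain ⟨σ₁, hσ₁τ, hsub⟩ := eventually_subcritical_of_permanentNodes hcl hl hρ2 hdss hκ' hXd hconf' hrest hnode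
  have hC : ∀ s : ℝ, s ≤ σ₁ → (-s) * ‖curl (u s) (ODE.evolutionMap u τ₀ s x₀)‖ ≤ 4 * K := by
    intro s hs
    have hs0 : 0 < -s := by linarith [hs.trans hσ₁τ]
    have h1 := norm_curl_le_four_mul (u s) (X s)
    have h2 := (hK s (by linarith) (X s) (hconf' s (hs.trans hσ₁τ))).1
    calc (-s) * ‖curl (u s) (X s)‖ ≤ (-s) * (4 * ‖fderiv ℝ (u s) (X s)‖) := mul_le_mul_of_nonneg_left h1 hs0.le
      _ = 4 * ((-s) * ‖fderiv ℝ (u s) (X s)‖) := by ring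
      _ ≤ 4 * K := by linarith
  exact curl_eq_zero_of_eventually_subcritical hcl hΛc hΛ hτ₀ hσ₁τ (by linarith : (1 + κ) / 2 < 1) hsub hC

/-! ### Member level: K-A for DSS members, pierced form -/

/-- **DSS MEMBERS WITH PIERCED MOVING SPHERES, A SUB-BERNOULLI PRESSURE CLOCK AND SUBCRITICAL PERMANENT NODES ARE TRIVIAL** (ns-cas-k2 g0's K-A′
`ae_eq_zero_of_gauge_of_piercing_of_confinedNull_allRho` with `hconf` DISCHARGED for DSS members; no tameness, no bounded profile).  Crux hypotheses
verbatim (every `ρ > 0`) + classical with a continuous gradient majorant + velocity class DSS law (`l > 1`) + pressure clock (`θ < 1`) + scale-invariant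
pressure bounds on the moving balls (automatic under the pressure DSS law, `…DSSSimilarityPressure`) + pointwise-subcritical exactly self-similar particle paths +
irrotational fast-inflow piercing beyond every radius ⇒ `u = 0` a.e. [folklore] -/
theorem ae_eq_zero_of_gauge_of_dss_piercing_of_clock (hρ : 0 < ρ)
    {H : ℝ → EuclideanSpace ℝ (Fin 3) → EuclideanSpace ℝ (Fin 3) →L[ℝ] EuclideanSpace ℝ (Fin 3)} {c₀ : ℝ≥0}
    (hsw : IsSuitableWeakSolutionOn (slab (EuclideanSpace ℝ (Fin 3)) (Iio 0) isOpen_Iio) 0 0 u p)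
    (hH : HasWeakSpatialGradientOn (slab (EuclideanSpace ℝ (Fin 3)) (Iio 0) isOpen_Iio) u H)
    (hgauge : ∀ a : ℝ, 0 < a →
      ENNReal.ofReal (a ^ (2 * ρ)) * cknA a (0 : ℝ × EuclideanSpace ℝ (Fin 3)) u +
          ENNReal.ofReal (a ^ ρ) * cknE a (0 : ℝ × EuclideanSpace ℝ (Fin 3)) H +
        ENNReal.ofReal (a ^ (2 * ρ)) * cknD a (0 : ℝ × EuclideanSpace ℝ (Fin 3)) p ≤ (c₀ : ℝ≥0∞))
    (hcl : IsClassicalEulerSolutionOn (Iio 0) 0 u p) (hΛc : ContinuousOn Λ (Iio 0))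
    (hΛ : ∀ s : ℝ, s < 0 → ∀ y, ‖fderiv ℝ (u s) y‖ ≤ Λ s) (hl : 1 < l)
    (hdss : ∀ τ : ℝ, τ < 0 → ∀ y, u τ y = (l ^ (1 + ρ)) • u ((l ^ (2 + ρ)) * τ) (l • y))
    (hθ : θ < 1)
    (hclock : ∀ s : ℝ, s < 0 → ∀ x : EuclideanSpace ℝ (Fin 3),
      (-s) * timeDerivWithin (Iio 0) p s x - (2 + ρ)⁻¹ * fderiv ℝ (p s) x x - 2 * (1 - (2 + ρ)⁻¹) * p s x ≤
        θ * (1 - 2 * (2 + ρ)⁻¹) * ‖u s x + ((2 + ρ)⁻¹ / (-s)) • x‖ ^ 2)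
    (hcoreP : ∀ R : ℝ, 0 < R → ∃ P₀ G : ℝ,
      ∀ s : ℝ, s < 0 → ∀ x : EuclideanSpace ℝ (Fin 3), ‖x‖ ≤ R * (-s) ^ (2 + ρ)⁻¹ →
        (-s) ^ (2 - 2 * (2 + ρ)⁻¹) * p s x ≤ P₀ ∧ (-s) ^ (2 - (2 + ρ)⁻¹) * ‖gradient (p s) x‖ ≤ G)
    (hnodes : ∀ y : EuclideanSpace ℝ (Fin 3),
      (∀ t : ℝ, t < 0 → u t ((-t) ^ (2 + ρ)⁻¹ • y) = (-((2 + ρ)⁻¹ * (-t) ^ ((2 + ρ)⁻¹ - 1))) • y) →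
      ∀ t : ℝ, t < 0 → ∀ v : EuclideanSpace ℝ (Fin 3), v ≠ 0 →
        (-t) * ⟪fderiv ℝ (u t) ((-t) ^ (2 + ρ)⁻¹ • y) v, v⟫ < ‖v‖ ^ 2)
    (hS : ∀ R₀ : ℝ, ∃ R : ℝ, R₀ ≤ R ∧ ∀ σ : ℝ, σ < 0 → ∀ x : EuclideanSpace ℝ (Fin 3), ‖x‖ = R * (-σ) ^ (2 + ρ)⁻¹ →
      ⟪x, u σ x⟫ ≤ -((2 + ρ)⁻¹ * ‖x‖ ^ 2 / (-σ)) → curl (u σ) x = 0) :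
    uncurry u =ᵐ[volume.restrict (Iio (0 : ℝ) ×ˢ (univ : Set (EuclideanSpace ℝ (Fin 3))))] 0 := by
  have hρ2 : 0 < 2 + ρ := by linarith
  refine ae_eq_zero_of_gauge_of_piercing_of_confinedNull_allRho (n := (2 + ρ)⁻¹) hρ hsw hH hgauge hcl hΛc hΛ hS
    fun τ₀ hτ₀ R hR => ?_
  obtain ⟨K, hK⟩ := exists_velocity_core_bounds_of_dss hcl.smooth_velocity hl hρ2 hdss R
  obtain ⟨P₀, G, hPG⟩ := hcoreP R hR
  obtain ⟨κ, hκ, hnode⟩ := exists_subcritical_const_of_pointwise hcl hl hρ2 hdss (R := R) fun y _ hperm => hnodes y hperm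
  have hempty : {x : EuclideanSpace ℝ (Fin 3) | curl (u τ₀) x ≠ 0 ∧
      ∀ σ : ℝ, σ ≤ τ₀ → ‖ODE.evolutionMap u τ₀ σ x‖ < R * (-σ) ^ (2 + ρ)⁻¹} = ∅ := by
    refine eq_empty_iff_forall_notMem.2 fun x hx => hx.1 ?_
    exact dss_curl_eq_zero_of_confined_core hcl hΛc hΛ hρ hl hdss hK hθ hclock hκ (fun s hs y hy => (hPG s hs y hy).1)
      (fun s hs y hy => (hPG s hs y hy).2) hnode hτ₀ fun s hs => (hx.2 s hs).le
  rw [hempty, measure_empty]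

/-! ### Portrait: for members with bounded scaled speed the confined-null binder is the whole problem -/

/-- **PORTRAIT (why K-A cannot be closed through `hconf` alone).**  For a classical member with a continuous gradient majorant whose scaled speed
`(−σ)^{1−n}‖u(σ,x)‖` is bounded by `b` on all moving spheres `‖x‖ = R(−σ)ⁿ`, `R ≥ R₁` (`n > 0`; e.g. a DSS member with bounded profile), ns-cas-k2 g0's
confined-null binder `hconf` («vortical points with a confined backward trajectory are null», every `τ₀ < 0`, `R > 0`) ALREADY forces an irrotational past:
no fast-inflow point exists on the spheres `R > b/n`, so the piercing hypothesis of `curl_eq_zero_of_piercing_of_confinedNull` holds vacuously.  Hence for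
such members `hconf` is equivalent to `curl u ≡ 0` — it is the core Liouville problem, not a side condition. [folklore] -/
theorem curl_eq_zero_of_confinedNull_of_boundedSpeed {n : ℝ} (hcl : IsClassicalEulerSolutionOn (Iio 0) 0 u p)
    (hΛc : ContinuousOn Λ (Iio 0)) (hΛ : ∀ s : ℝ, s < 0 → ∀ y, ‖fderiv ℝ (u s) y‖ ≤ Λ s) (hn0 : 0 < n) {b R₁ : ℝ}
    (hb : ∀ R : ℝ, R₁ ≤ R → ∀ σ : ℝ, σ < 0 → ∀ x : EuclideanSpace ℝ (Fin 3), ‖x‖ = R * (-σ) ^ n →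
      (-σ) ^ (1 - n) * ‖u σ x‖ ≤ b)
    (hconf : ∀ τ₀ : ℝ, τ₀ < 0 → ∀ R : ℝ, 0 < R →
      volume {x : EuclideanSpace ℝ (Fin 3) | curl (u τ₀) x ≠ 0 ∧
        ∀ σ : ℝ, σ ≤ τ₀ → ‖ODE.evolutionMap u τ₀ σ x‖ < R * (-σ) ^ n} = 0)
    {τ₀ : ℝ} (hτ₀ : τ₀ < 0) (x₀ : EuclideanSpace ℝ (Fin 3)) : curl (u τ₀) x₀ = 0 := by
  refine curl_eq_zero_of_piercing_of_confinedNull hcl hΛc hΛ (fun R₀ => ?_) hconf hτ₀ x₀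
  set R : ℝ := max (max R₀ R₁) (b / n + 1) with hR
  have hR₁ : R₁ ≤ R := (le_max_right _ _).trans (le_max_left _ _)
  have hbR : b < n * R := by
    have h1 : b / n + 1 ≤ R := le_max_right _ _
    have h2 : b / n < R := by linarith
    rwa [div_lt_iff₀ hn0, mul_comm] at h2
  exact ⟨R, (le_max_left _ _).trans (le_max_left _ _), fun σ hσ x hx hfast =>
    absurd hfast (not_le.2 (noFastInflow_of_boundedSpeed hσ hbR (hb R hR₁ σ hσ) hx))⟩

end Summit.NavierStokesRegularity.NavierStokesRegularity.Theorems.PowerGaugeEulerLiouville.SimilarityBernoulli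

end
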